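import Mathlib
import HarnessLib
import Summits.HubbardSuperconductivity.HubbardSuperconductivity.Theorems.KLProgrammeThinLevelSetVolume
import Summits.HubbardSuperconductivity.HubbardSuperconductivity.Theorems.KLProgrammeThinLevelSetRadialGrowth

/-!
# Route `KLProgramme` — K3 engine (stmt-HubbardSuperconductivity-20437), stub (b) (ℓ)/(I2)–(I3), located item «ABS-UMK-COUNT» / «UV-REMEASURE-COUNT»:
# lattice points in thin level sets, part 4 — the SYMMETRIC TRIPLE SUM `G(x, y) = f(x) + f(y) + f(τ − x − y)`

Cell gate-hubbard-kl, seat p4 g14 (pen (R133)(ii)).  After the graph reparametrisation of a corner bundle (tangential coordinate `u`, normal displacement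
`f(u)` with `f″ ≍ κ`), slicing over all free legs but three and eliminating one by the (then LINEAR) tangential conservation, the normal conservation of the
last three legs of equal sign is the thin level window `|f(x) + f(y) + f(τ − x − y) − β| ≤ δ` for the PAIR `(x, y)` of tangential coordinates (memo
HOME/prover-p4/UV-REMEASURE-COUNT.md §4, blueprint).  This file verifies the hypotheses of `card_mul_pow_le_of_levelWindow` (part 2) for this function on
sup-norm balls about its critical point `(τ/3, τ/3)` from ONE-VARIABLE bounds `c ≤ f″ ≤ A`, `|f′| ≤ B` on `[τ/3 − 2ρ′, τ/3 + 2ρ′]`, and concludes: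

* `card_mul_sq_le_tripleSum` — an `h`-separated finite set of points `p` of the sup-ball of radius `ρ` about `(τ/3, τ/3)` with
  `|f(p₀) + f(p₁) + f(τ − p₀ − p₁) − β| ≤ δ` has `#P · h² ≤ 960·A·(2δ + (4B+1)h)/c²` (`ρ + h/2 ≤ ρ′`): `O((δ + h)/h²)` points, one factor `h` below the box count.

Everything is PROVED; no definitions, no named facts; generic calculus. [folklore]
-/

noncomputable section

open Real Set MeasureTheory Metric

namespace Summit.HubbardSuperconductivity.HubbardSuperconductivity.Theorems.ThinLevelSet

set_option linter.dupNamespace false -- summit = problem name (single-conjunct summit), D-0017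

/-! ## §1 Derivatives of the triple sum along lines -/

/-- First derivative of `s ↦ f(p₀ + s v₀) + f(p₁ + s v₁) + f(τ − (p₀ + s v₀) − (p₁ + s v₁))`. [folklore] -/
theorem hasDerivAt_tripleSum_line {f f' : ℝ → ℝ} (hf : ∀ u, HasDerivAt f (f' u) u) (τ p₀ p₁ v₀ v₁ s : ℝ) :
    HasDerivAt (fun s : ℝ => f (p₀ + s * v₀) + f (p₁ + s * v₁) + f (τ - (p₀ + s * v₀) - (p₁ + s * v₁)))
      (f' (p₀ + s * v₀) * v₀ + f' (p₁ + s * v₁) * v₁ + f' (τ - (p₀ + s * v₀) - (p₁ + s * v₁)) * (0 - v₀ - v₁)) s := by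
  have h₀ : HasDerivAt (fun s : ℝ => p₀ + s * v₀) v₀ s := by
    simpa using ((hasDerivAt_id s).mul_const v₀).const_add p₀
  have h₁ : HasDerivAt (fun s : ℝ => p₁ + s * v₁) v₁ s := by
    simpa using ((hasDerivAt_id s).mul_const v₁).const_add p₁
  have h₂ : HasDerivAt (fun s : ℝ => τ - (p₀ + s * v₀) - (p₁ + s * v₁)) (0 - v₀ - v₁) s :=
    ((hasDerivAt_const s τ).sub h₀).sub h₁
  exact (((hf _).comp s h₀).add ((hf _).comp s h₁)).add ((hf _).comp s h₂)

/-- Second derivative of the same line function. [folklore] -/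
theorem hasDerivAt_tripleSum_line_deriv {f' f'' : ℝ → ℝ} (hf' : ∀ u, HasDerivAt f' (f'' u) u) (τ p₀ p₁ v₀ v₁ s : ℝ) :
    HasDerivAt (fun s : ℝ => f' (p₀ + s * v₀) * v₀ + f' (p₁ + s * v₁) * v₁ + f' (τ - (p₀ + s * v₀) - (p₁ + s * v₁)) * (0 - v₀ - v₁))
      (f'' (p₀ + s * v₀) * v₀ * v₀ + f'' (p₁ + s * v₁) * v₁ * v₁ +
        f'' (τ - (p₀ + s * v₀) - (p₁ + s * v₁)) * (0 - v₀ - v₁) * (0 - v₀ - v₁)) s := by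
  have h₀ : HasDerivAt (fun s : ℝ => p₀ + s * v₀) v₀ s := by
    simpa using ((hasDerivAt_id s).mul_const v₀).const_add p₀
  have h₁ : HasDerivAt (fun s : ℝ => p₁ + s * v₁) v₁ s := by
    simpa using ((hasDerivAt_id s).mul_const v₁).const_add p₁
  have h₂ : HasDerivAt (fun s : ℝ => τ - (p₀ + s * v₀) - (p₁ + s * v₁)) (0 - v₀ - v₁) s :=
    ((hasDerivAt_const s τ).sub h₀).sub h₁
  exact ((((hf' _).comp s h₀).mul_const v₀).add (((hf' _).comp s h₁).mul_const v₁)).add (((hf' _).comp s h₂).mul_const _)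

/-! ## §2 The pair count -/

/-- Coordinates of a point of the sup-ball of radius `r` about the diagonal point `(τ/3, τ/3)`: `|p i − τ/3| ≤ r`. [folklore] -/
theorem abs_sub_le_of_mem_closedBall_diag {τ r : ℝ} {p : Fin 2 → ℝ} (hp : p ∈ Metric.closedBall (fun _ : Fin 2 => τ / 3) r) (i : Fin 2) :
    |p i - τ / 3| ≤ r := by
  rw [mem_closedBall] at hp
  have h := (dist_le_pi_dist p (fun _ : Fin 2 => τ / 3) i).trans hp
  rwa [Real.dist_eq] at h

/-- Each coordinate is dominated by the sup norm: `(v i)² ≤ ‖v‖²`. [folklore] -/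
theorem sq_apply_le_norm_sq (v : Fin 2 → ℝ) (i : Fin 2) : v i ^ 2 ≤ ‖v‖ ^ 2 := by
  have h : |v i| ≤ ‖v‖ := by
    have := norm_le_pi_norm v i
    rwa [Real.norm_eq_abs] at this
  calc v i ^ 2 = |v i| ^ 2 := (sq_abs _).symm
    _ ≤ ‖v‖ ^ 2 := pow_le_pow_left₀ (abs_nonneg _) h 2

set_option maxHeartbeats 400000 in -- many hypothesis dischargers for the part-2 theorem in one proof; 200k is marginal
/-- **The pair count for the symmetric triple sum.**  Let `f` be twice differentiable with `c ≤ f″ ≤ A` (`0 < c ≤ A`) and `|f′| ≤ B` on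
`[τ/3 − 2ρ′, τ/3 + 2ρ′]`.  If `P` is a finite set of points of `Fin 2 → ℝ`, pairwise at sup-distance `≥ h > 0`, all in the sup-ball of radius `ρ` about `(τ/3, τ/3)`
with `ρ + h/2 ≤ ρ′`, and all in the level window `|f(p₀) + f(p₁) + f(τ − p₀ − p₁) − β| ≤ δ` (`δ ≥ 0`), then `#P · h² ≤ 960·A·(2δ + (4B + 1)h)/c²`.
(The minimiser of the triple sum is the diagonal point; along every segment from it the second derivative is `f″v₀² + f″v₁² + f″(v₀+v₁)² ∈ [c‖v‖², 6A‖v‖²]`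
in the sup norm; the sum is `4B`-Lipschitz; then `card_mul_pow_le_of_levelWindow` in dimension 2.) [folklore] -/
theorem card_mul_sq_le_tripleSum {f f' f'' : ℝ → ℝ} (hf : ∀ u, HasDerivAt f (f' u) u) (hf' : ∀ u, HasDerivAt f' (f'' u) u)
    {τ ρ ρ' c A B h δ β : ℝ} (hρ : 0 ≤ ρ) (hh : 0 < h) (hρ' : ρ + h / 2 ≤ ρ') (hc : 0 < c) (hcA : c ≤ A) (hB : 0 ≤ B) (hδ : 0 ≤ δ)
    (hfloor : ∀ u ∈ Icc (τ / 3 - 2 * ρ') (τ / 3 + 2 * ρ'), c ≤ f'' u)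
    (hceil : ∀ u ∈ Icc (τ / 3 - 2 * ρ') (τ / 3 + 2 * ρ'), f'' u ≤ A)
    (hder : ∀ u ∈ Icc (τ / 3 - 2 * ρ') (τ / 3 + 2 * ρ'), |f' u| ≤ B)
    (P : Finset (Fin 2 → ℝ)) (hsep : ∀ p ∈ P, ∀ q ∈ P, p ≠ q → h ≤ dist p q)
    (hP : ∀ p ∈ P, p ∈ Metric.closedBall (fun _ : Fin 2 => τ / 3) ρ ∧ |f (p 0) + f (p 1) + f (τ - p 0 - p 1) - β| ≤ δ) :
    (P.card : ℝ) * h ^ 2 ≤ 960 * A * (2 * δ + (4 * B + 1) * h) / c ^ 2 := by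
  have hA : 0 < A := hc.trans_le hcA
  have hρ'0 : 0 < ρ' := by linarith
  set xs : Fin 2 → ℝ := fun _ => τ / 3 with hxs
  set D : Set (Fin 2 → ℝ) := Metric.closedBall xs ρ with hD
  set D' : Set (Fin 2 → ℝ) := Metric.closedBall xs ρ' with hD'
  set F : (Fin 2 → ℝ) → ℝ := fun p => f (p 0) + f (p 1) + f (τ - p 0 - p 1) with hFdef
  set I : Set ℝ := Icc (τ / 3 - 2 * ρ') (τ / 3 + 2 * ρ') with hI
  -- points of `D′`: coordinates (and the third argument) in `I`
  have hcoord : ∀ p ∈ D', p 0 ∈ I ∧ p 1 ∈ I ∧ τ - p 0 - p 1 ∈ I := by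
    intro p hp
    have h0 := abs_le.1 (abs_sub_le_of_mem_closedBall_diag hp 0)
    have h1 := abs_le.1 (abs_sub_le_of_mem_closedBall_diag hp 1)
    refine ⟨⟨by linarith, by linarith⟩, ⟨by linarith, by linarith⟩, ⟨by linarith, by linarith⟩⟩
  -- the segment `y + s (x − y)` stays in the convex set `D′`
  have hD'c : Convex ℝ D' := convex_closedBall _ _
  have hseg : ∀ x ∈ D', ∀ y ∈ D', ∀ s ∈ Icc (0 : ℝ) 1, y + s • (x - y) ∈ D' := by
    intro x hx y hy s hs
    have := hD'c hy hx (by linarith [hs.2] : (0 : ℝ) ≤ 1 - s) hs.1 (by ring)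
    have e : (1 - s) • y + s • x = y + s • (x - y) := by
      rw [smul_sub, sub_smul, one_smul]; abel
    rw [e] at this; exact this
  -- the function along a line, in coordinates
  have hline : ∀ (y v : Fin 2 → ℝ) (s : ℝ), F (y + s • v) =
      f (y 0 + s * v 0) + f (y 1 + s * v 1) + f (τ - (y 0 + s * v 0) - (y 1 + s * v 1)) := by
    intro y v s
    simp only [hFdef, Pi.add_apply, Pi.smul_apply, smul_eq_mul]
  -- Lipschitz on `D′` with constant `4B`
  have hLip : ∀ x ∈ D', ∀ y ∈ D', |F x - F y| ≤ 4 * B * dist x y := by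
    intro x hx y hy
    set v := x - y with hv
    set φ : ℝ → ℝ := fun s => f (y 0 + s * v 0) + f (y 1 + s * v 1) + f (τ - (y 0 + s * v 0) - (y 1 + s * v 1)) with hφ
    have hφd : ∀ s, HasDerivAt φ (f' (y 0 + s * v 0) * v 0 + f' (y 1 + s * v 1) * v 1 +
        f' (τ - (y 0 + s * v 0) - (y 1 + s * v 1)) * (0 - v 0 - v 1)) s :=
      fun s => hasDerivAt_tripleSum_line hf τ (y 0) (y 1) (v 0) (v 1) s
    have hbound : ∀ s ∈ Ico (0 : ℝ) 1, ‖f' (y 0 + s * v 0) * v 0 + f' (y 1 + s * v 1) * v 1 +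
        f' (τ - (y 0 + s * v 0) - (y 1 + s * v 1)) * (0 - v 0 - v 1)‖ ≤ 4 * B * ‖v‖ := by
      intro s hs
      have hmem : y + s • v ∈ D' := hseg x hx y hy s (Ico_subset_Icc_self hs)
      obtain ⟨hc0, hc1, hc2⟩ := hcoord _ hmem
      simp only [Pi.add_apply, Pi.smul_apply, smul_eq_mul] at hc0 hc1 hc2
      have hb0 := hder _ hc0
      have hb1 := hder _ hc1
      have hb2 := hder _ hc2
      have hv0 : |v 0| ≤ ‖v‖ := by have := norm_le_pi_norm v 0; rwa [Real.norm_eq_abs] at this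
      have hv1 : |v 1| ≤ ‖v‖ := by have := norm_le_pi_norm v 1; rwa [Real.norm_eq_abs] at this
      rw [Real.norm_eq_abs]
      calc |f' (y 0 + s * v 0) * v 0 + f' (y 1 + s * v 1) * v 1 + f' (τ - (y 0 + s * v 0) - (y 1 + s * v 1)) * (0 - v 0 - v 1)|
          ≤ |f' (y 0 + s * v 0) * v 0| + |f' (y 1 + s * v 1) * v 1| + |f' (τ - (y 0 + s * v 0) - (y 1 + s * v 1)) * (0 - v 0 - v 1)| :=
            abs_add_three _ _ _
        _ = |f' (y 0 + s * v 0)| * |v 0| + |f' (y 1 + s * v 1)| * |v 1| + |f' (τ - (y 0 + s * v 0) - (y 1 + s * v 1))| * |0 - v 0 - v 1| := by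
            rw [abs_mul, abs_mul, abs_mul]
        _ ≤ B * ‖v‖ + B * ‖v‖ + B * (‖v‖ + ‖v‖) := by
            have h3 : |0 - v 0 - v 1| ≤ ‖v‖ + ‖v‖ := by
              calc |0 - v 0 - v 1| = |v 0 + v 1| := by rw [show (0 : ℝ) - v 0 - v 1 = -(v 0 + v 1) by ring, abs_neg]
                _ ≤ |v 0| + |v 1| := abs_add_le _ _
                _ ≤ ‖v‖ + ‖v‖ := add_le_add hv0 hv1
            gcongr
        _ = 4 * B * ‖v‖ := by ring
    have hmv := norm_image_sub_le_of_norm_deriv_le_segment_01' (fun s hs => (hφd s).hasDerivWithinAt) hbound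
    have e1 : φ 1 = F x := by
      have h1 := hline y v 1
      have hx' : y + (1 : ℝ) • v = x := by rw [hv, one_smul]; abel
      rw [hx'] at h1
      simp only [hφ]
      rw [h1]
    have e0 : φ 0 = F y := by
      simp only [hφ, hFdef, zero_mul, add_zero]
    rw [e1, e0, Real.norm_eq_abs] at hmv
    rwa [dist_eq_norm]
  -- radial growth and radial upper bound about `xs` on `D′`
  have hxsD' : xs ∈ D' := mem_closedBall_self hρ'0.le
  have hgrow : ∀ x ∈ D', ∀ t : ℝ, 0 ≤ t → t ≤ 1 →
      F (AffineMap.homothety xs t x) ≤ F x - c / 2 * (1 - t ^ 2) * ‖x - xs‖ ^ 2 := by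
    intro x hx t ht0 ht1
    set v := x - xs with hv
    have hfun : (fun s : ℝ => F (AffineMap.homothety xs s x)) =
        fun s => f (τ / 3 + s * v 0) + f (τ / 3 + s * v 1) + f (τ - (τ / 3 + s * v 0) - (τ / 3 + s * v 1)) := by
      funext s
      rw [homothety_eq_add_smul, hline]
    have hg : ∀ s, HasDerivAt (fun s : ℝ => F (AffineMap.homothety xs s x))
        (f' (τ / 3 + s * v 0) * v 0 + f' (τ / 3 + s * v 1) * v 1 + f' (τ - (τ / 3 + s * v 0) - (τ / 3 + s * v 1)) * (0 - v 0 - v 1)) s := by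
      intro s; rw [hfun]; exact hasDerivAt_tripleSum_line hf τ (τ / 3) (τ / 3) (v 0) (v 1) s
    have hg' := fun s => hasDerivAt_tripleSum_line_deriv hf' τ (τ / 3) (τ / 3) (v 0) (v 1) s
    have h0 : (0 : ℝ) ≤ f' (τ / 3 + 0 * v 0) * v 0 + f' (τ / 3 + 0 * v 1) * v 1 +
        f' (τ - (τ / 3 + 0 * v 0) - (τ / 3 + 0 * v 1)) * (0 - v 0 - v 1) := by
      have e : τ - (τ / 3 + 0 * v 0) - (τ / 3 + 0 * v 1) = τ / 3 := by ring
      rw [e, zero_mul, zero_mul, add_zero]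
      nlinarith
    refine radialGrowth_of_segment hg hg' h0 (fun s hs => ?_) ht0 ht1
    -- the floor along the segment: the three arguments are in `I`
    have hmem : xs + s • v ∈ D' := by
      have := hseg x hx xs hxsD' s hs
      simpa [hv] using this
    obtain ⟨hc0, hc1, hc2⟩ := hcoord _ hmem
    simp only [Pi.add_apply, Pi.smul_apply, smul_eq_mul, hxs] at hc0 hc1 hc2
    have h0' := hfloor _ hc0
    have h1' := hfloor _ hc1
    have h2' := hfloor _ hc2
    -- sup norm vs sum of squares on `Fin 2 → ℝ` (inlined; the tree's `Literature.Analysis.PDE.norm_sq_le_sum_sq` states the same)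
    have hn : ‖v‖ ^ 2 ≤ v 0 ^ 2 + v 1 ^ 2 := by
      have hle : ‖v‖ ≤ Real.sqrt (v 0 ^ 2 + v 1 ^ 2) := by
        refine (pi_norm_le_iff_of_nonneg (Real.sqrt_nonneg _)).2 fun i => ?_
        rw [Real.norm_eq_abs, ← Real.sqrt_sq_eq_abs]
        apply Real.sqrt_le_sqrt
        fin_cases i <;> simp <;> nlinarith [sq_nonneg (v 0), sq_nonneg (v 1)]
      calc ‖v‖ ^ 2 ≤ Real.sqrt (v 0 ^ 2 + v 1 ^ 2) ^ 2 := pow_le_pow_left₀ (norm_nonneg _) hle 2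
        _ = v 0 ^ 2 + v 1 ^ 2 := Real.sq_sqrt (by positivity)
    have hsq : 0 ≤ (0 - v 0 - v 1) * (0 - v 0 - v 1) := mul_self_nonneg _
    nlinarith [mul_nonneg (sub_nonneg.2 hcA) hsq, h0', h1', h2', sq_nonneg (v 0), sq_nonneg (v 1),
      mul_le_mul_of_nonneg_right h0' (sq_nonneg (v 0)), mul_le_mul_of_nonneg_right h1' (sq_nonneg (v 1)),
      mul_le_mul_of_nonneg_right h2' hsq]
  have hup : ∀ x ∈ D', F x - F xs ≤ 6 * A / 2 * ‖x - xs‖ ^ 2 := by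
    intro x hx
    set v := x - xs with hv
    have hfun : (fun s : ℝ => F (AffineMap.homothety xs s x)) =
        fun s => f (τ / 3 + s * v 0) + f (τ / 3 + s * v 1) + f (τ - (τ / 3 + s * v 0) - (τ / 3 + s * v 1)) := by
      funext s
      rw [homothety_eq_add_smul, hline]
    have hg : ∀ s, HasDerivAt (fun s : ℝ => F (AffineMap.homothety xs s x))
        (f' (τ / 3 + s * v 0) * v 0 + f' (τ / 3 + s * v 1) * v 1 + f' (τ - (τ / 3 + s * v 0) - (τ / 3 + s * v 1)) * (0 - v 0 - v 1)) s := by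
      intro s; rw [hfun]; exact hasDerivAt_tripleSum_line hf τ (τ / 3) (τ / 3) (v 0) (v 1) s
    have hg' := fun s => hasDerivAt_tripleSum_line_deriv hf' τ (τ / 3) (τ / 3) (v 0) (v 1) s
    have h0 : f' (τ / 3 + 0 * v 0) * v 0 + f' (τ / 3 + 0 * v 1) * v 1 +
        f' (τ - (τ / 3 + 0 * v 0) - (τ / 3 + 0 * v 1)) * (0 - v 0 - v 1) ≤ 0 := by
      have e : τ - (τ / 3 + 0 * v 0) - (τ / 3 + 0 * v 1) = τ / 3 := by ring
      rw [e, zero_mul, zero_mul, add_zero]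
      nlinarith
    refine radialUpper_of_segment hg hg' h0 (fun s hs => ?_)
    have hmem : xs + s • v ∈ D' := by
      have := hseg x hx xs hxsD' s hs
      simpa [hv] using this
    obtain ⟨hc0, hc1, hc2⟩ := hcoord _ hmem
    simp only [Pi.add_apply, Pi.smul_apply, smul_eq_mul, hxs] at hc0 hc1 hc2
    have h0' := hceil _ hc0
    have h1' := hceil _ hc1
    have h2' := hceil _ hc2
    have hv0 := sq_apply_le_norm_sq v 0
    have hv1 := sq_apply_le_norm_sq v 1
    have hsq : (0 - v 0 - v 1) * (0 - v 0 - v 1) ≤ 2 * (v 0 ^ 2 + v 1 ^ 2) := by nlinarith [sq_nonneg (v 0 - v 1)]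
    have hsq0 : 0 ≤ (0 - v 0 - v 1) * (0 - v 0 - v 1) := mul_self_nonneg _
    nlinarith [mul_le_mul_of_nonneg_right h0' (sq_nonneg (v 0)), mul_le_mul_of_nonneg_right h1' (sq_nonneg (v 1)),
      mul_le_mul_of_nonneg_right h2' hsq0, mul_le_mul_of_nonneg_left hsq hA.le]
  -- measurability of `F` (continuity of `f`)
  have hfc : Continuous f := continuous_iff_continuousAt.2 fun u => (hf u).continuousAt
  have hFm : Measurable F := by
    have hFc : Continuous F := by
      simp only [hFdef]
      fun_prop
    exact hFc.measurable
  -- the geometric inclusions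
  have hDD' : D ⊆ D' := Metric.closedBall_subset_closedBall (by linarith)
  have hthick : Metric.thickening (h / 2) D ⊆ D' := by
    intro x hx
    obtain ⟨z, hz, hxz⟩ := Metric.mem_thickening_iff.1 hx
    rw [hD, mem_closedBall] at hz
    rw [hD', mem_closedBall]
    linarith [dist_triangle x z xs]
  -- apply part 2 in dimension 2
  have hmain := card_mul_pow_le_of_levelWindow (ι := Fin 2) hDD' hh hthick hD'c measurableSet_closedBall hFm hxsD'
    hc (by linarith : c ≤ 6 * A) hρ'0.le (by positivity : (0 : ℝ) ≤ 4 * B) (subset_refl _) (by simp) hLip hgrow hup β δ hδ P hsep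
    (fun p hp => ⟨(hP p hp).1, by simpa [hFdef] using (hP p hp).2⟩)
  simp only [Fintype.card_fin] at hmain
  -- simplify the dimension-2 bound
  have hδ'0 : 0 ≤ 2 * δ + (4 * B + 1) * h := by positivity
  have e1 : (2 * Real.sqrt (12 * (2 : ℕ) * (6 * A) * (2 * δ + (4 * B + 1) * h)) / c) ^ 2 =
      4 * (12 * 2 * (6 * A) * (2 * δ + (4 * B + 1) * h)) / c ^ 2 := by
    rw [div_pow, mul_pow, Real.sq_sqrt (by positivity)]
    push_cast; ring
  have e2 : (2 * Real.sqrt (2 / c)) ^ 2 = 4 * (2 / c) := by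
    rw [mul_pow, Real.sq_sqrt (by positivity)]; ring
  rw [e1, e2] at hmain
  simp only [Nat.cast_ofNat, Nat.sub_self, pow_zero, mul_one] at hmain
  have e3 : 4 * (12 * 2 * (6 * A) * (2 * δ + (4 * B + 1) * h)) / c ^ 2 + 4 * 2 * (6 * A) * (2 * δ + (4 * B + 1) * h) / c * (4 * (2 / c)) =
      960 * A * (2 * δ + (4 * B + 1) * h) / c ^ 2 := by
    field_simp; ring
  linarith [hmain, e3.le, e3.ge]

end Summit.HubbardSuperconductivity.HubbardSuperconductivity.Theorems.ThinLevelSet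

end
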